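import Literature.Analysis.FluidPDE.MildL3SmoothAssembly
import Literature.Analysis.FluidPDE.KNSSLocalSmoothingHolds
import HarnessLib

/-!
# Mild `C([0,T); L³)` solutions are smooth: the discharge of `mild_L3_smooth`

Analysis/FluidPDE leaf file (proofs only). `Literature.Analysis.FluidPDE.mild_L3_smooth`
(`NSLerayHopfSereginProofs.lean`; Giga 1986, J. Differential Equations 62, Thm. 4 and the Remark
following it, p. 202: "The mild solution `u` constructed above is a classical smooth solution …
`u` belongs to `C^∞(Ω̄ × (0,T₀))`"; Lemarié-Rieusset 2016, proof of Thm. 15.1 (A), p. 565, with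
Thm. 9.12, Thm. 7.5, Thm. 7.7) was reduced in the tree to the single named fact (L)
`knss2009_local_smoothing ℝ³` (`mild_L3_smooth_of_local`, `MildL3SmoothAssembly.lean`: Kato's
weighted `L³` theory `kato_local_L3_holds`, the restart `mild_L3_restart_holds`, interior
boundedness `mild_L3_interior_bounded_holds`, and the classical representation of bounded mild
solutions `classical_of_bounded_mild_L3_of_knss2009_smoothing` /
`knss2009_smoothing_three_of_local`). With (L) discharged (`knss2009_local_smoothing_holds`,
`KNSSLocalSmoothingHolds.lean`: the weighted Picard iteration of KNSS 2009, Prop. 4.1) the fact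
follows, and with it Seregin's blow-up criterion from the mild local theory
(`seregin_L3_blowup_of_mild_local`).

## References

* Y. Giga, *Solutions for semilinear parabolic equations in `Lᵖ` and regularity of weak solutions
  of the Navier–Stokes system*, J. Differential Equations 62 (1986) 186–212, Thm. 4 and Remark
  (p. 202). [Giga1986]
* P. G. Lemarié-Rieusset, *The Navier–Stokes Problem in the 21st Century*, CRC Press 2016,
  doi:10.1201/b19556, Thm. 15.1 (A) (proof, p. 565), Thm. 9.12, Thm. 7.5, Thm. 7.7. [LemarieRieusset2016]
* G. Koch, N. Nadirashvili, G. Seregin, V. Šverák, *Liouville theorems for the Navier–Stokes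
  equations and applications*, Acta Math. 203 (2009) = arXiv:0709.3599, Prop. 4.1. [KochNadirashviliSereginSverak2009]
-/

namespace Literature.Analysis.FluidPDE

/-- **Giga 1986, Thm. 4 and Remark; Lemarié-Rieusset 2016, Thm. 15.1 (A)**: mild solutions in
`C([0,T); L³(ℝ³))` of the Navier–Stokes equations (duality form, `L³` weakly divergence-free
datum) are represented for positive times by a classical solution `(w, π)` on `(0, T)`.
Discharge of the named fact `mild_L3_smooth` through `mild_L3_smooth_of_local` and the KNSS local
smoothing theory `knss2009_local_smoothing_holds`. [cite: Giga1986, Thm. 4 and Remark (p. 202)] -/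
theorem mild_L3_smooth_holds : mild_L3_smooth :=
  mild_L3_smooth_of_local (knss2009_local_smoothing_holds (EuclideanSpace ℝ (Fin 3)))

/-- **Seregin's `L³` blow-up criterion from Lemarié-Rieusset's mild form alone**: the tree's
`seregin_L3_blowup_of_facts` (Seregin 2012; Lemarié-Rieusset 2016, Thm. 15.13 from Thm. 15.5
and Thm. 15.1 (A)) with `mild_L3_smooth` discharged. [cite: LemarieRieusset2016, Thm. 15.13 with Thm. 15.1 (A)] -/
theorem seregin_L3_blowup_of_seregin_mild (h15 : seregin_L3_blowup_mild) : seregin_L3_blowup :=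
  seregin_L3_blowup_of_facts h15 mild_L3_smooth_holds

end Literature.Analysis.FluidPDE
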